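import Summits.BirchSwinnertonDyer.BirchSwinnertonDyer.Theorems.KimAtThreeDeepLowerOffStratumLevelLoweringDepleteConditionOne
import Summits.BirchSwinnertonDyer.BirchSwinnertonDyer.Theorems.KimAtThreeDeepLowerOffStratumLevelLoweringMultiStabData
import HarnessLib

/-!
# Route `KimAtThreeKolyvagin` (rung W2), crux `DeepLowerAtThreeOffKatoStratum` (item 19679), registered
# stub `stub_nonAdditive`, ROAD (b^k,add): the `k`-FOLD DEPLETION of a form of the Hecke family at a squarefree set
# `A` of primes dividing the optimal level (Condition 1, integrality, number field, real eigen-structure)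

Cell `bsd-addord`, seat `bsd-addord-w2-acc2`, gen 7; item `stmt-BirchSwinnertonDyer-19679` (`--supports`, closes
nothing). ROAD (b^k,add) file 2. Starting from a form `G₀ ∈ S₂(Γ₀(M₀R₀))` of the Hecke family of a newform `g` of
level `M₀` with all the data of gen 6's `…MultiStabData.exists_multiStab` (eigenform, normalised, `3`-integral,
number field, Vatsal's Condition 1, `a_p(G₀) = a_p(g)` off `R₀`, `a_p(G₀) ≡ af p` on `R₀`, membership in the ℂ-span
of the real-coefficient `T_r = a_r(g)` forms), and a squarefree `A` prime to `R₀` with `ℓ ∣ M₀`, `a_ℓ(g) ≠ 0` for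
every prime `ℓ ∣ A`, the `k`-fold DEPLETION `(∏_{ℓ ∣ A}(ι₁ − a_ℓ ι_ℓ)) G₀ ∈ S₂(Γ₀(M₀R₀A))` keeps all the data, with
`a_ℓ = 0` at the primes of `A` (one prime at a time: `…DepleteConditionOne`). This is the comparison-form producer
for the rows with DROPPING additive places (`a_ℓ(f_E) = 0` there). Theorems only; no definition, no fact.

* ★ `exists_multiDeplete`.
[cite: Vatsal1999, (1.2) Condition 1] [cite: DiamondShurman2005, §5.7 and Prop. 5.6.2] [cite: AtkinLehner1970, Thm. 3, Thm. 5]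
-/

set_option autoImplicit false
-- the Theorems namespace of a single-conjunct summit repeats the summit name by design (D-0017)
set_option linter.dupNamespace false

noncomputable section

open scoped MatrixGroups ModularForm Classical NNReal

open CongruenceSubgroup WeierstrassCurve Literature.NumberTheory.EllipticCurves
  Literature.NumberTheory.EllipticCurves.ModularForms
open UpperHalfPlane hiding I

namespace Summit.BirchSwinnertonDyer.BirchSwinnertonDyer.Theorems.KimAtThreeDeepLowerOffStratumLevelLoweringMultiDepleteData

open Summit.BirchSwinnertonDyer.BirchSwinnertonDyer.Theorems.KimAtThreeDeepLowerOffStratumLevelLoweringConditionOne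
open Summit.BirchSwinnertonDyer.BirchSwinnertonDyer.Theorems.KimAtThreeDeepLowerOffStratumLevelLoweringVatsalStab
  (cuspCoeff_stab isNormalized_stab)
open Summit.BirchSwinnertonDyer.BirchSwinnertonDyer.Theorems.KimAtThreeDeepLowerOffStratumLevelLoweringStabEigenform
  renaming heckeT_stab_of_ne → heckeT_stab_of_ne_eig, heckeT_stab_self → heckeT_stab_self_eig,
    isHeckeEigenform_stab → isHeckeEigenform_stab_eig, cuspCoeff_stab_prime → cuspCoeff_stab_prime_eig,
    cuspCoeff_mul_cuspCoeff → cuspCoeff_mul_cuspCoeff_eig, heckeEigenvalue_stab → heckeEigenvalue_stab_eig,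
    valuation_cuspCoeff_stab_le_one → valuation_cuspCoeff_stab_le_one_eig,
    finiteDimensional_coeffField_stab → finiteDimensional_coeffField_stab_eig
open Summit.BirchSwinnertonDyer.BirchSwinnertonDyer.Theorems.KimAtThreeDeepLowerOffStratumLevelLoweringMultiStabData
  (iota_mem_span_realEigen)
open Summit.BirchSwinnertonDyer.BirchSwinnertonDyer.Theorems.KimAtThreeDeepLowerOffStratumLevelLoweringDepleteConditionOne

section Induction

variable {M₀ R₀ : ℕ} [NeZero M₀] [NeZero R₀] {g : CuspForm (Gamma0 M₀) 2} (hg : IsNewform0 g)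
  (ι : PadicAlgCl 3 ≃+* ℂ) (af : ℕ → ℂ) {G₀ : CuspForm (Gamma0 (M₀ * R₀)) 2}
  (h₀eig : IsHeckeEigenform G₀) (h₀norm : IsNormalized G₀) (h₀int : ∀ n : ℕ, Valued.v (ι.symm (cuspCoeff G₀ n)) ≤ 1)
  (h₀fd : FiniteDimensional ℚ (coeffField G₀)) (h₀C : HasSimpleHeckeGenEigenspace G₀)
  (h₀g : ∀ p : ℕ, p.Prime → ¬ p ∣ R₀ → cuspCoeff G₀ p = cuspCoeff g p)
  (h₀f : ∀ p : ℕ, p.Prime → p ∣ R₀ → Valued.v (ι.symm (af p - cuspCoeff G₀ p)) < 1)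
  (h₀span : G₀ ∈ Submodule.span ℂ {ψ : CuspForm (Gamma0 (M₀ * R₀)) 2 | (∀ m, (cuspCoeff ψ m).im = 0) ∧
    ∀ (r : ℕ) (hr : r.Prime), ¬ r ∣ M₀ * R₀ →
      (haveI : NeZero r := ⟨hr.ne_zero⟩; heckeT (Gamma0 (M₀ * R₀)) 2 r ψ) = cuspCoeff g r • ψ})
include hg h₀eig h₀norm h₀int h₀fd h₀C h₀g h₀f h₀span

/-- ★ **THE `k`-FOLD DEPLETION.** Let `g ∈ S₂(Γ₀(M₀))` be a newform and `G₀ ∈ S₂(Γ₀(M₀R₀))` a normalised Hecke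
eigenform of its family with the data of `exists_multiStab` (relative to the set `R₀` and the target values `af`).
Let `A` be squarefree, prime to `R₀`, with `ℓ ∣ M₀` and `a_ℓ(g) ≠ 0` for every prime `ℓ ∣ A`. Then at level
`L = M₀R₀A` there is a normalised Hecke eigenform `G` with `3`-integral coefficients in a number field, satisfying
Vatsal's Condition 1, with `a_p(G) = a_p(g)` for primes `p ∤ R₀A`, `a_p(G) ≡ af p` for primes `p ∣ R₀`, `a_ℓ(G) = 0`
for primes `ℓ ∣ A`, lying in the complex span of the real-coefficient forms of level `L` on which every `T_r`,
`r ∤ L`, acts by `a_r(g)`: the iterated depletion `(∏_{ℓ ∣ A}(ι₁ − a_ℓ ι_ℓ)) G₀`, one prime at a time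
(`…DepleteConditionOne.hasSimpleHeckeGenEigenspace_deplete_of_hasSimpleHeckeGenEigenspace`).
[cite: Vatsal1999, (1.2) Condition 1] [cite: DiamondShurman2005, §5.7 and Prop. 5.6.2] [cite: AtkinLehner1970, Thm. 5] -/
theorem exists_multiDeplete :
    ∀ (A : ℕ), Squarefree A → Nat.Coprime A R₀ →
      (∀ ℓ : ℕ, ℓ.Prime → ℓ ∣ A → ℓ ∣ M₀ ∧ cuspCoeff g ℓ ≠ 0) →
      ∀ (L : ℕ) [NeZero L], L = M₀ * R₀ * A →
        ∃ G : CuspForm (Gamma0 L) 2,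
          IsHeckeEigenform G ∧ IsNormalized G ∧ (∀ n : ℕ, Valued.v (ι.symm (cuspCoeff G n)) ≤ 1) ∧
          FiniteDimensional ℚ (coeffField G) ∧ HasSimpleHeckeGenEigenspace G ∧
          (∀ p : ℕ, p.Prime → ¬ p ∣ R₀ * A → cuspCoeff G p = cuspCoeff g p) ∧
          (∀ p : ℕ, p.Prime → p ∣ R₀ → Valued.v (ι.symm (af p - cuspCoeff G p)) < 1) ∧
          (∀ ℓ : ℕ, ℓ.Prime → ℓ ∣ A → cuspCoeff G ℓ = 0) ∧
          G ∈ Submodule.span ℂ {ψ : CuspForm (Gamma0 L) 2 | (∀ m, (cuspCoeff ψ m).im = 0) ∧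
            ∀ (r : ℕ) (hr : r.Prime), ¬ r ∣ L →
              (haveI : NeZero r := ⟨hr.ne_zero⟩; heckeT (Gamma0 L) 2 r ψ) = cuspCoeff g r • ψ} := by
  intro A
  induction A using Nat.strong_induction_on with
  | _ A ih =>
    intro hAsq hAR₀ hAat L _ hL
    by_cases hA1 : A = 1
    · -- base: `A = 1`, `G = G₀`
      subst hA1
      obtain rfl : L = M₀ * R₀ := by rw [hL, mul_one]
      exact ⟨G₀, h₀eig, h₀norm, h₀int, h₀fd, h₀C, fun p hp hpR ↦ h₀g p hp (by rwa [mul_one] at hpR), h₀f,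
        fun ℓ hℓ hℓ1 ↦ absurd (Nat.eq_one_of_dvd_one hℓ1) hℓ.ne_one, h₀span⟩
    · -- step: `A = ℓ A'` with `ℓ` prime, `ℓ ∤ A'`
      obtain ⟨ℓ, hℓ, hℓA⟩ := Nat.exists_prime_and_dvd hA1
      obtain ⟨A', rfl⟩ := hℓA
      obtain ⟨hℓA', -, hA'sq⟩ := Nat.squarefree_mul_iff.mp hAsq
      have hℓA'' : ¬ ℓ ∣ A' := fun h ↦ hℓ.ne_one (Nat.Coprime.eq_one_of_dvd hℓA' h)
      have hA'R₀ : Nat.Coprime A' R₀ := Nat.Coprime.coprime_dvd_left (dvd_mul_left A' ℓ) hAR₀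
      have hℓR₀ : ¬ ℓ ∣ R₀ := fun h ↦
        hℓ.ne_one (Nat.Coprime.eq_one_of_dvd (Nat.Coprime.coprime_dvd_left (dvd_mul_right ℓ A') hAR₀) h)
      obtain ⟨hℓM₀, hgℓ⟩ := hAat ℓ hℓ (dvd_mul_right ℓ A')
      have hA'0 : A' ≠ 0 := Squarefree.ne_zero hA'sq
      haveI : NeZero A' := ⟨hA'0⟩
      haveI : NeZero ℓ := ⟨hℓ.ne_zero⟩
      have hA'lt : A' < ℓ * A' := by
        have := hℓ.two_le
        have hpos := Nat.pos_of_ne_zero hA'0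
        nlinarith
      -- the form at level `M₀ R₀ A'`
      obtain ⟨G', hG'eig, hG'norm, hG'int, hG'fd, hG'C, hG'g, hG'f, hG'z, hG'span⟩ :=
        ih A' hA'lt hA'sq hA'R₀ (fun p hp hpA' ↦ hAat p hp (hpA'.mul_left ℓ)) (M₀ * R₀ * A') rfl
      have hℓR : ¬ ℓ ∣ R₀ * A' := by
        intro h
        rcases (Nat.Prime.dvd_mul hℓ).mp h with h | h
        · exact hℓR₀ h
        · exact hℓA'' h
      have h1 : M₀ * R₀ * A' * 1 ∣ M₀ * R₀ * A' * ℓ := mul_dvd_mul_left _ (one_dvd ℓ)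
      have hℓℓ : M₀ * R₀ * A' * ℓ ∣ M₀ * R₀ * A' * ℓ := dvd_rfl
      have hGℓ : cuspCoeff G' ℓ = cuspCoeff g ℓ := hG'g ℓ hℓ hℓR
      have hne : cuspCoeff G' ℓ ≠ 0 := by rw [hGℓ]; exact hgℓ
      set a : ℂ := cuspCoeff G' ℓ with hadef
      -- the data of the new form `G = ι₁ G' − a ι_ℓ G'` at level `M₀ R₀ A' ℓ = L`
      have hGeig : IsHeckeEigenform (iota (M₀ * R₀ * A') (M₀ * R₀ * A' * ℓ) 1 2 h1 G' -
          a • iota (M₀ * R₀ * A') (M₀ * R₀ * A' * ℓ) ℓ 2 hℓℓ G') :=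
        isHeckeEigenform_deplete h1 hℓℓ hG'eig hG'norm hℓ ((hℓM₀.mul_right R₀).mul_right A')
      have hGnorm : IsNormalized (iota (M₀ * R₀ * A') (M₀ * R₀ * A' * ℓ) 1 2 h1 G' -
          a • iota (M₀ * R₀ * A') (M₀ * R₀ * A' * ℓ) ℓ 2 hℓℓ G') :=
        isNormalized_stab G' a h1 hℓℓ hG'norm hℓ
      have hGint : ∀ n : ℕ, Valued.v (ι.symm (cuspCoeff (iota (M₀ * R₀ * A') (M₀ * R₀ * A' * ℓ) 1 2 h1 G' -
          a • iota (M₀ * R₀ * A') (M₀ * R₀ * A' * ℓ) ℓ 2 hℓℓ G') n)) ≤ 1 :=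
        valuation_cuspCoeff_stab_le_one_of_le h1 hℓℓ ι hG'int (hG'int ℓ)
      have hGfd : FiniteDimensional ℚ (coeffField (iota (M₀ * R₀ * A') (M₀ * R₀ * A' * ℓ) 1 2 h1 G' -
          a • iota (M₀ * R₀ * A') (M₀ * R₀ * A' * ℓ) ℓ 2 hℓℓ G')) :=
        finiteDimensional_coeffField_stab_of_mem h1 hℓℓ hG'fd (coeff_mem_coeffField G' ℓ)
      have hGC : HasSimpleHeckeGenEigenspace (iota (M₀ * R₀ * A') (M₀ * R₀ * A' * ℓ) 1 2 h1 G' -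
          a • iota (M₀ * R₀ * A') (M₀ * R₀ * A' * ℓ) ℓ 2 hℓℓ G') :=
        hasSimpleHeckeGenEigenspace_deplete_of_hasSimpleHeckeGenEigenspace hg h1 hℓℓ (R := R₀ * A') (mul_assoc M₀ R₀ A')
          hG'eig hG'norm hG'C (fun p hp hpL ↦ hG'g p hp fun h ↦ hpL (by rw [mul_assoc]; exact h.mul_left M₀)) hℓ hℓM₀
          hℓR hGℓ hne
      have hGp : ∀ {p : ℕ}, p.Prime →
          cuspCoeff (iota (M₀ * R₀ * A') (M₀ * R₀ * A' * ℓ) 1 2 h1 G' -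
            a • iota (M₀ * R₀ * A') (M₀ * R₀ * A' * ℓ) ℓ 2 hℓℓ G') p = if p = ℓ then a - a else cuspCoeff G' p :=
        fun hp ↦ cuspCoeff_stab_prime_eig hG'norm a h1 hℓℓ hℓ hp
      have hGspan : ∀ {d : ℕ} [NeZero d] (hd : M₀ * R₀ * A' * d ∣ M₀ * R₀ * A' * ℓ), d = 1 ∨ d = ℓ →
          iota (M₀ * R₀ * A') (M₀ * R₀ * A' * ℓ) d 2 hd G' ∈
            Submodule.span ℂ {ψ' : CuspForm (Gamma0 (M₀ * R₀ * A' * ℓ)) 2 |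
              (∀ m, (cuspCoeff ψ' m).im = 0) ∧ ∀ (r : ℕ) (hr : r.Prime), ¬ r ∣ M₀ * R₀ * A' * ℓ →
                (haveI : NeZero r := ⟨hr.ne_zero⟩; heckeT (Gamma0 (M₀ * R₀ * A' * ℓ)) 2 r ψ') = cuspCoeff g r • ψ'} := by
        intro d _ hd hdℓ
        refine (Submodule.map_span_le (iota (M₀ * R₀ * A') (M₀ * R₀ * A' * ℓ) d 2 hd) _ _ |>.mpr ?_)
          (Submodule.mem_map_of_mem hG'span)
        rintro ψ ⟨hreal, hT⟩
        exact iota_mem_span_realEigen (fun r ↦ cuspCoeff g r) hℓ hd hdℓ hreal hT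
      obtain rfl : L = M₀ * R₀ * A' * ℓ := by rw [hL]; ring
      refine ⟨iota (M₀ * R₀ * A') (M₀ * R₀ * A' * ℓ) 1 2 h1 G' - a • iota (M₀ * R₀ * A') (M₀ * R₀ * A' * ℓ) ℓ 2 hℓℓ G',
        hGeig, hGnorm, hGint, hGfd, hGC, fun p hp hpRA ↦ ?_, fun p hp hpR ↦ ?_, fun p hp hpA ↦ ?_,
        Submodule.sub_mem _ (hGspan h1 (Or.inl rfl)) (Submodule.smul_mem _ _ (hGspan hℓℓ (Or.inr rfl)))⟩
      · -- `a_p(G) = a_p(g)` off `R₀ A`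
        have hpℓ : p ≠ ℓ := by rintro rfl; exact hpRA (dvd_mul_of_dvd_right (dvd_mul_right p A') R₀)
        have hpRA' : ¬ p ∣ R₀ * A' := fun h ↦ hpRA (by
          rcases (Nat.Prime.dvd_mul hp).mp h with h | h
          · exact h.mul_right _
          · exact dvd_mul_of_dvd_right (h.mul_left ℓ) R₀)
        rw [hGp hp, if_neg hpℓ, hG'g p hp hpRA']
      · -- `a_p(G) ≡ af p` on `R₀`
        have hpℓ : p ≠ ℓ := by rintro rfl; exact hℓR₀ hpR
        rw [hGp hp, if_neg hpℓ]
        exact hG'f p hp hpR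
      · -- `a_ℓ'(G) = 0` on `A = ℓ A'`
        rw [hGp hp]
        by_cases hpℓ : p = ℓ
        · rw [if_pos hpℓ, sub_self]
        · rw [if_neg hpℓ]
          have hpA' : p ∣ A' := by
            rcases (Nat.Prime.dvd_mul hp).mp hpA with h | h
            · exact absurd ((Nat.prime_dvd_prime_iff_eq hp hℓ).mp h) hpℓ
            · exact h
          exact hG'z p hp hpA'

end Induction

end Summit.BirchSwinnertonDyer.BirchSwinnertonDyer.Theorems.KimAtThreeDeepLowerOffStratumLevelLoweringMultiDepleteData

end
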